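import Mathlib.Analysis.Calculus.Deriv.MeanValue
import Mathlib.Analysis.SpecialFunctions.ExpDeriv
import Mathlib.MeasureTheory.Integral.IntervalIntegral.FundThmCalculus

/-!
# Crux `PerpetualPump.AveragedTypeIBlowup` (stmt-NavierStokesRegularity-1835), line `Sketch`:
# stub `linearComparison` — integrating-factor comparison for scalar linear differential
# inequalities

This file proves the registered stub `stub_linearComparison` of the line skeleton
`Cruxes/AveragedTypeIBlowup/Lines/Sketch.lean`: the scalar comparison principle that drives every
phase of the window one-step theorem (incubation decay, slaved modes, trail), in three parts.

* (upper) If `x, K, f` are continuous on `[t₀, t₁]` and `x' ≤ K x + f` at every interior point,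
  then `x(t) ≤ e^{∫_{t₀}^t K} (x(t₀) + ∫_{t₀}^t e^{-∫_{t₀}^s K} f(s) ds)` on `[t₀, t₁]` (no sign
  condition on `K`).
* (lower) The same with all inequalities reversed (`K x + f ≤ x'`).
* (damped corollary) If `|x' + R x| ≤ R G` inside, then
  `|x(t)| ≤ |x(t₀)| e^{-R (t - t₀)} + G (1 - e^{-R (t - t₀)})`.

Proof (Mathlib only). With the primitive `P(t) = ∫_{t₀}^t K` (continuous on `[t₀,t₁]`,
derivative `K t` at interior points by `intervalIntegral.integral_hasDerivAt_right`) and the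
integrating factor `Φ = e^{-P}`, the function `y = Φ x - ∫_{t₀}^· Φ f` is continuous on `[t₀, t₁]`
with interior derivative `Φ (x' - K x - f) ≤ 0`, hence antitone
(`antitoneOn_of_hasDerivWithinAt_nonpos`); `y(t) ≤ y(t₀) = x(t₀)` is the upper bound after
multiplication by `e^{P(t)}`. The lower bound is the upper bound for `-x, -f`; the damped corollary
is both bounds with `K ≡ -R`, `f ≡ ± R G` and the explicit integral
`∫_{t₀}^t e^{(s - t₀) R} R G ds = G (e^{(t - t₀) R} - 1)`.

## References

Standard ODE comparison / Grönwall argument (folklore); used as in T. Tao, *Finite time blowup for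
an averaged three-dimensional Navier–Stokes equation*, J. Amer. Math. Soc. 29 (2016), §5–6.
-/

noncomputable section

-- the summit namespace `…NavierStokesRegularity.NavierStokesRegularity…` is the tree convention
set_option linter.dupNamespace false

open MeasureTheory Set Filter Topology

namespace Summit.NavierStokesRegularity.NavierStokesRegularity.Theorems.PerpetualPumpAveragedTypeIBlowup

/-- **Primitive of a continuous function.** If `K` is continuous on `[t₀, t₁]`, then
`t ↦ ∫_{t₀}^t K` is continuous on `[t₀, t₁]` and has derivative `K t` at every interior point `t`.
[folklore] -/
theorem linearComparison_primitive {K : ℝ → ℝ} {t₀ t₁ : ℝ} (h01 : t₀ ≤ t₁)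
    (hK : ContinuousOn K (Icc t₀ t₁)) :
    ContinuousOn (fun t => ∫ s in t₀..t, K s) (Icc t₀ t₁) ∧
      ∀ t ∈ Ioo t₀ t₁, HasDerivAt (fun t => ∫ s in t₀..t, K s) (K t) t := by
  refine ⟨?_, fun t ht => ?_⟩
  · have h := intervalIntegral.continuousOn_primitive_interval' (μ := volume)
      (hK.intervalIntegrable_of_Icc h01) left_mem_uIcc
    rwa [uIcc_of_le h01] at h
  · exact intervalIntegral.integral_hasDerivAt_right
      ((hK.mono (Icc_subset_Icc_right ht.2.le)).intervalIntegrable_of_Icc ht.1.le)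
      ((hK.mono Ioo_subset_Icc_self).stronglyMeasurableAtFilter isOpen_Ioo t ht)
      (hK.continuousAt (Icc_mem_nhds ht.1 ht.2))

/-- **The integrating-factor monotonicity.** If `x, K, f` are continuous on `[t₀, t₁]` and
`x' ≤ K x + f` at interior points, then
`t ↦ e^{-∫_{t₀}^t K} x(t) - ∫_{t₀}^t e^{-∫_{t₀}^s K} f(s) ds` is antitone on `[t₀, t₁]`
(its interior derivative is `e^{-∫K} (x' - K x - f) ≤ 0`). [folklore] -/
theorem linearComparison_antitone {x K f : ℝ → ℝ} {t₀ t₁ : ℝ} (h01 : t₀ ≤ t₁)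
    (hK : ContinuousOn K (Icc t₀ t₁)) (hf : ContinuousOn f (Icc t₀ t₁))
    (hx : ContinuousOn x (Icc t₀ t₁))
    (hd : ∀ t ∈ Ioo t₀ t₁, ∃ x' : ℝ, HasDerivAt x x' t ∧ x' ≤ K t * x t + f t) :
    AntitoneOn (fun t => Real.exp (-(∫ s in t₀..t, K s)) * x t -
      ∫ s in t₀..t, Real.exp (-(∫ u in t₀..s, K u)) * f s) (Icc t₀ t₁) := by
  obtain ⟨hPc, hPd⟩ := linearComparison_primitive h01 hK
  have hΦc : ContinuousOn (fun t => Real.exp (-(∫ s in t₀..t, K s))) (Icc t₀ t₁) := hPc.neg.rexp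
  have hgc : ContinuousOn (fun s => Real.exp (-(∫ u in t₀..s, K u)) * f s) (Icc t₀ t₁) :=
    hΦc.mul hf
  obtain ⟨hIc, hId⟩ := linearComparison_primitive h01 hgc
  refine antitoneOn_of_hasDerivWithinAt_nonpos (convex_Icc t₀ t₁)
    (f' := fun t => Real.exp (-(∫ s in t₀..t, K s)) * -K t * x t +
      Real.exp (-(∫ s in t₀..t, K s)) * deriv x t - Real.exp (-(∫ u in t₀..t, K u)) * f t)
    ((hΦc.mul hx).sub hIc) ?_ ?_
  · intro t ht
    rw [interior_Icc] at ht
    obtain ⟨x', hx', -⟩ := hd t ht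
    exact (((hPd t ht).neg.exp.mul hx'.differentiableAt.hasDerivAt).sub
      (hId t ht)).hasDerivWithinAt
  · intro t ht
    rw [interior_Icc] at ht
    obtain ⟨x', hx', hle⟩ := hd t ht
    rw [hx'.deriv]
    have hE := Real.exp_pos (-(∫ s in t₀..t, K s))
    have h1 := mul_le_mul_of_nonneg_left hle hE.le
    linarith

/-- **Linear comparison, upper bound.** If `x, K, f` are continuous on `[t₀, t₁]` and
`x' ≤ K x + f` at interior points, then
`x(t) ≤ e^{∫_{t₀}^t K} (x(t₀) + ∫_{t₀}^t e^{-∫_{t₀}^s K} f(s) ds)` for `t ∈ [t₀, t₁]`. [folklore] -/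
theorem linearComparison_upper {x K f : ℝ → ℝ} {t₀ t₁ : ℝ} (h01 : t₀ ≤ t₁)
    (hK : ContinuousOn K (Icc t₀ t₁)) (hf : ContinuousOn f (Icc t₀ t₁))
    (hx : ContinuousOn x (Icc t₀ t₁))
    (hd : ∀ t ∈ Ioo t₀ t₁, ∃ x' : ℝ, HasDerivAt x x' t ∧ x' ≤ K t * x t + f t) {t : ℝ}
    (ht : t ∈ Icc t₀ t₁) :
    x t ≤ Real.exp (∫ s in t₀..t, K s) *
      (x t₀ + ∫ s in t₀..t, Real.exp (-(∫ u in t₀..s, K u)) * f s) := by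
  have h := linearComparison_antitone h01 hK hf hx hd (left_mem_Icc.2 h01) ht ht.1
  simp only [intervalIntegral.integral_same, neg_zero, Real.exp_zero, one_mul, sub_zero] at h
  have hE := Real.exp_pos (∫ s in t₀..t, K s)
  have h1 : Real.exp (∫ s in t₀..t, K s) * Real.exp (-(∫ s in t₀..t, K s)) = 1 := by
    rw [← Real.exp_add, add_neg_cancel, Real.exp_zero]
  have h2 := mul_le_mul_of_nonneg_left h hE.le
  have h3 : Real.exp (∫ s in t₀..t, K s) * (Real.exp (-(∫ s in t₀..t, K s)) * x t) = x t := by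
    rw [← mul_assoc, h1, one_mul]
  linarith

/-- **Linear comparison, lower bound.** If `x, K, f` are continuous on `[t₀, t₁]` and
`K x + f ≤ x'` at interior points, then
`e^{∫_{t₀}^t K} (x(t₀) + ∫_{t₀}^t e^{-∫_{t₀}^s K} f(s) ds) ≤ x(t)` for `t ∈ [t₀, t₁]`
(the upper bound applied to `-x`, `-f`). [folklore] -/
theorem linearComparison_lower {x K f : ℝ → ℝ} {t₀ t₁ : ℝ} (h01 : t₀ ≤ t₁)
    (hK : ContinuousOn K (Icc t₀ t₁)) (hf : ContinuousOn f (Icc t₀ t₁))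
    (hx : ContinuousOn x (Icc t₀ t₁))
    (hd : ∀ t ∈ Ioo t₀ t₁, ∃ x' : ℝ, HasDerivAt x x' t ∧ K t * x t + f t ≤ x') {t : ℝ}
    (ht : t ∈ Icc t₀ t₁) :
    Real.exp (∫ s in t₀..t, K s) *
      (x t₀ + ∫ s in t₀..t, Real.exp (-(∫ u in t₀..s, K u)) * f s) ≤ x t := by
  have hd' : ∀ s ∈ Ioo t₀ t₁, ∃ x' : ℝ, HasDerivAt (fun t => -x t) x' s ∧
      x' ≤ K s * (-x s) + (-f s) := by
    intro s hs
    obtain ⟨x', hx', hle⟩ := hd s hs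
    exact ⟨-x', hx'.neg, by linarith⟩
  have h := linearComparison_upper h01 hK hf.neg hx.neg hd' ht
  simp only [Pi.neg_apply, mul_neg, intervalIntegral.integral_neg] at h
  linarith

/-- **An explicit integral.** `∫_{t₀}^t e^{(s - t₀) R} (R G) ds = G (e^{(t - t₀) R} - 1)`
(fundamental theorem of calculus for the antiderivative `G e^{(s - t₀) R}`). [folklore] -/
theorem linearComparison_integral_exp (R G t₀ t : ℝ) :
    ∫ s in t₀..t, Real.exp ((s - t₀) * R) * (R * G) = G * (Real.exp ((t - t₀) * R) - 1) := by
  have hderiv : ∀ s : ℝ, HasDerivAt (fun s => G * Real.exp ((s - t₀) * R))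
      (G * (Real.exp ((s - t₀) * R) * (1 * R))) s := fun s =>
    (((hasDerivAt_id' s).sub_const t₀).mul_const R).exp.const_mul G
  have hcont : Continuous fun s : ℝ => G * (Real.exp ((s - t₀) * R) * (1 * R)) := by fun_prop
  have key : ∫ s in t₀..t, G * (Real.exp ((s - t₀) * R) * (1 * R)) =
      G * Real.exp ((t - t₀) * R) - G * Real.exp ((t₀ - t₀) * R) :=
    intervalIntegral.integral_eq_sub_of_hasDerivAt (fun s _ => hderiv s)
      (hcont.intervalIntegrable t₀ t)
  have hfun : (fun s => Real.exp ((s - t₀) * R) * (R * G)) =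
      fun s => G * (Real.exp ((s - t₀) * R) * (1 * R)) := by
    funext s
    ring
  rw [hfun, key, sub_self, zero_mul, Real.exp_zero]
  ring

/-- **Damped corollary.** If `x` is continuous on `[t₀, t₁]` and `|x' + R x| ≤ R G` at interior
points, then `|x(t)| ≤ |x(t₀)| e^{-R (t - t₀)} + G (1 - e^{-R (t - t₀)})` for `t ∈ [t₀, t₁]`
(both comparison bounds with `K ≡ -R`, `f ≡ ± R G`). [folklore] -/
theorem linearComparison_damped {x : ℝ → ℝ} {R G t₀ t₁ : ℝ} (h01 : t₀ ≤ t₁)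
    (hx : ContinuousOn x (Icc t₀ t₁))
    (hd : ∀ t ∈ Ioo t₀ t₁, ∃ x' : ℝ, HasDerivAt x x' t ∧ |x' + R * x t| ≤ R * G) {t : ℝ}
    (ht : t ∈ Icc t₀ t₁) :
    |x t| ≤ |x t₀| * Real.exp (-(R * (t - t₀))) + G * (1 - Real.exp (-(R * (t - t₀)))) := by
  have hK : ContinuousOn (fun _ : ℝ => -R) (Icc t₀ t₁) := continuousOn_const
  have hf₁ : ContinuousOn (fun _ : ℝ => R * G) (Icc t₀ t₁) := continuousOn_const
  have hf₂ : ContinuousOn (fun _ : ℝ => -(R * G)) (Icc t₀ t₁) := continuousOn_const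
  have hd₁ : ∀ s ∈ Ioo t₀ t₁, ∃ x' : ℝ, HasDerivAt x x' s ∧ x' ≤ -R * x s + R * G := by
    intro s hs
    obtain ⟨x', hx', hle⟩ := hd s hs
    exact ⟨x', hx', by linarith [(abs_le.1 hle).2]⟩
  have hd₂ : ∀ s ∈ Ioo t₀ t₁, ∃ x' : ℝ, HasDerivAt x x' s ∧ -R * x s + -(R * G) ≤ x' := by
    intro s hs
    obtain ⟨x', hx', hle⟩ := hd s hs
    exact ⟨x', hx', by linarith [(abs_le.1 hle).1]⟩
  have hup := linearComparison_upper h01 hK hf₁ hx hd₁ ht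
  have hlo := linearComparison_lower h01 hK hf₂ hx hd₂ ht
  simp only [intervalIntegral.integral_const, smul_eq_mul, mul_neg, neg_neg,
    intervalIntegral.integral_neg, linearComparison_integral_exp] at hup hlo
  have he : 0 < Real.exp (-((t - t₀) * R)) := Real.exp_pos _
  have hee : Real.exp (-((t - t₀) * R)) * Real.exp ((t - t₀) * R) = 1 := by
    rw [← Real.exp_add, neg_add_cancel, Real.exp_zero]
  have h2 : Real.exp (-((t - t₀) * R)) * (G * (Real.exp ((t - t₀) * R) - 1)) =
      G * (1 - Real.exp (-((t - t₀) * R))) := by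
    linear_combination G * hee
  have h1 := mul_le_mul_of_nonneg_right (neg_abs_le (x t₀)) he.le
  have h3 := mul_le_mul_of_nonneg_right (le_abs_self (x t₀)) he.le
  rw [mul_comm R (t - t₀), abs_le]
  constructor
  · linarith
  · linarith

/-- **Registered stub `stub_linearComparison`** (line `Sketch` of crux
`PerpetualPump.AveragedTypeIBlowup`, stmt-NavierStokesRegularity-1835): the integrating-factor
comparison for `x' ≤ K x + f` (upper bound), its reversed form `K x + f ≤ x'` (lower bound), and
the damped corollary
`|x' + R x| ≤ R G ⇒ |x(t)| ≤ |x(t₀)| e^{-R (t - t₀)} + G (1 - e^{-R (t - t₀)})`, for functions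
continuous on `[t₀, t₁]` and differentiable inside. [folklore] -/
theorem stub_linearComparison :
    (∀ (x K f : ℝ → ℝ) (t₀ t₁ : ℝ), t₀ ≤ t₁ →
      ContinuousOn K (Icc t₀ t₁) → ContinuousOn f (Icc t₀ t₁) → ContinuousOn x (Icc t₀ t₁) →
      (∀ t ∈ Ioo t₀ t₁, ∃ x' : ℝ, HasDerivAt x x' t ∧ x' ≤ K t * x t + f t) →
      ∀ t ∈ Icc t₀ t₁,
        x t ≤ Real.exp (∫ s in t₀..t, K s) *
          (x t₀ + ∫ s in t₀..t, Real.exp (-(∫ u in t₀..s, K u)) * f s)) ∧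
    (∀ (x K f : ℝ → ℝ) (t₀ t₁ : ℝ), t₀ ≤ t₁ →
      ContinuousOn K (Icc t₀ t₁) → ContinuousOn f (Icc t₀ t₁) → ContinuousOn x (Icc t₀ t₁) →
      (∀ t ∈ Ioo t₀ t₁, ∃ x' : ℝ, HasDerivAt x x' t ∧ K t * x t + f t ≤ x') →
      ∀ t ∈ Icc t₀ t₁,
        Real.exp (∫ s in t₀..t, K s) *
          (x t₀ + ∫ s in t₀..t, Real.exp (-(∫ u in t₀..s, K u)) * f s) ≤ x t) ∧
    (∀ (x : ℝ → ℝ) (R G t₀ t₁ : ℝ), t₀ ≤ t₁ → 0 < R → 0 ≤ G → ContinuousOn x (Icc t₀ t₁) →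
      (∀ t ∈ Ioo t₀ t₁, ∃ x' : ℝ, HasDerivAt x x' t ∧ |x' + R * x t| ≤ R * G) →
      ∀ t ∈ Icc t₀ t₁,
        |x t| ≤ |x t₀| * Real.exp (-(R * (t - t₀))) + G * (1 - Real.exp (-(R * (t - t₀))))) :=
  ⟨fun _ _ _ _ _ h01 hK hf hx hd _ ht => linearComparison_upper h01 hK hf hx hd ht,
    fun _ _ _ _ _ h01 hK hf hx hd _ ht => linearComparison_lower h01 hK hf hx hd ht,
    fun _ _ _ _ _ h01 _ _ hx hd _ ht => linearComparison_damped h01 hx hd ht⟩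

end Summit.NavierStokesRegularity.NavierStokesRegularity.Theorems.PerpetualPumpAveragedTypeIBlowup

end
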